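import Mathlib.Analysis.Complex.BorelCaratheodory
import Mathlib.NumberTheory.LSeries.Basic
import Literature.Analysis.SpecialFunctions.DigammaLogBound
import HarnessLib

/-!
# Carathéodory ⟹ unit slack, part II: growth of `F` from the one-sided majorant

Sub-problem `RiemannHypothesis`, route `SignCone`, crux `ConeMagnification` (stmt-RiemannHypothesis-16303),
seat 0.  Support file for `unitSlack_of_cara` (the converse of the landed `stub_cara`).

Input: `F` holomorphic on `Re s > 1/2`, equal to `L_c(s) − 1/(s−1)` on `Re s > 1` for a real weight `c`
with `Σ |c(n)| n^{-σ} < ∞` (`σ > 1`), and the Carathéodory majorant (digamma form)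
`Re F(s) ≤ 1/2 + Re(1/s) + ½ Re ψ(s/2) − ½ log π`.
Output (`norm_le_linear_of_cara`): for every `δ > 0` a constant `C = C(δ)` with
`‖F(σ + it)‖ ≤ C (1 + |t|)` for `1/2 + δ ≤ σ ≤ 2` — by the Borel–Carathéodory theorem
(Mathlib `Complex.borelCaratheodory`) on the discs `|s − (2+it)| < 3/2`, where the majorant is
`≤ A₀ + log(1+|t|+3/2)` (`caraMajorant_le_log`, from `‖ψ(w)‖ ≤ C + log(1+|Im w|)` on the strip
`1/4 ≤ Re w ≤ 2`, `exists_norm_digamma_strip_le`) and `|F(2+it)| ≤ Σ|c(n)|n^{-2} + 1`.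

References: E. C. Titchmarsh, The Theory of Functions, §5.5 (Borel–Carathéodory); this route's `StubCara`.
-/

noncomputable section

-- `Summit.RiemannHypothesis.RiemannHypothesis.…` repeats a namespace component by design (D-0017 layout).
set_option linter.dupNamespace false

open Complex Filter Set Metric LSeries
open scoped Real Topology

namespace Summit.RiemannHypothesis.RiemannHypothesis.Theorems.SignConeConeMagnification

/-- **`ψ` on the strip `1/4 ≤ Re w ≤ 2`**: `‖ψ(w)‖ ≤ C + log(1 + |Im w|)` (`norm_digamma_le_log` for
`|Im w| ≥ 1/2`, compactness of `[1/4,2] × [−1/2,1/2]` for the rest). [folklore] -/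
theorem exists_norm_digamma_strip_le :
    ∃ C : ℝ, 0 ≤ C ∧ ∀ w : ℂ, 1 / 4 ≤ w.re → w.re ≤ 2 →
      ‖digamma w‖ ≤ C + Real.log (1 + |w.im|) := by
  set K : Set ℂ := Icc (1 / 4 : ℝ) 2 ×ℂ Icc (-(1 / 2 : ℝ)) (1 / 2) with hK
  have hKc : IsCompact K := isCompact_Icc.reProdIm isCompact_Icc
  have hKsub : K ⊆ {w : ℂ | 0 < w.re} := fun w hw => by
    have h1 := (mem_reProdIm.1 hw).1.1
    simp only [mem_setOf_eq]
    linarith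
  obtain ⟨M, hM⟩ := hKc.exists_bound_of_continuousOn
    (Literature.Analysis.SpecialFunctions.Complex.continuousOn_digamma.mono hKsub)
  refine ⟨max (max M (Real.log 3 + 8)) 0, le_max_right _ _, fun w h1 h2 => ?_⟩
  have hlog0 : 0 ≤ Real.log (1 + |w.im|) := Real.log_nonneg (by linarith [abs_nonneg w.im])
  rcases le_or_gt (1 / 2 : ℝ) |w.im| with hy | hy
  · have hw : 0 < w.re := by linarith
    have h := Literature.Analysis.SpecialFunctions.Complex.norm_digamma_le_log hw hy
    have hn : ‖w‖ ≤ 2 + |w.im| := by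
      refine (norm_le_abs_re_add_abs_im w).trans ?_
      rw [abs_of_pos hw]
      linarith
    have hl : Real.log (1 + ‖w‖) ≤ Real.log 3 + Real.log (1 + |w.im|) := by
      rw [← Real.log_mul (by norm_num) (by positivity)]
      exact Real.log_le_log (by positivity) (by nlinarith [abs_nonneg w.im])
    calc ‖digamma w‖ ≤ Real.log 3 + 8 + Real.log (1 + |w.im|) := by linarith
      _ ≤ max (max M (Real.log 3 + 8)) 0 + Real.log (1 + |w.im|) := by
          gcongr
          exact (le_max_right _ _).trans (le_max_left _ _)
  · have hwK : w ∈ K := by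
      refine mem_reProdIm.2 ⟨⟨h1, h2⟩, ?_, ?_⟩
      · linarith [(abs_lt.1 hy).1]
      · exact (abs_lt.1 hy).2.le
    calc ‖digamma w‖ ≤ M := hM _ hwK
      _ ≤ max (max M (Real.log 3 + 8)) 0 + Real.log (1 + |w.im|) := by
          linarith [(le_max_left M (Real.log 3 + 8)).trans (le_max_left _ (0 : ℝ))]

/-- **The Carathéodory majorant is logarithmic**: for `1/2 < Re s ≤ 4`,
`1/2 + Re(1/s) + ½Re ψ(s/2) − ½log π ≤ A₀ + log(1 + |Im s|)`. [folklore] -/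
theorem caraMajorant_le_log :
    ∃ A₀ : ℝ, 0 ≤ A₀ ∧ ∀ s : ℂ, 1 / 2 < s.re → s.re ≤ 4 →
      1 / 2 + (1 / s).re + (digamma (s / 2)).re / 2 - Real.log π / 2 ≤ A₀ + Real.log (1 + |s.im|) := by
  obtain ⟨C, hC0, hC⟩ := exists_norm_digamma_strip_le
  refine ⟨1 / 2 + 2 + C / 2, by positivity, fun s hs hs4 => ?_⟩
  have hlog0 : 0 ≤ Real.log (1 + |s.im|) := Real.log_nonneg (by linarith [abs_nonneg s.im])
  have hns : 1 / 2 < ‖s‖ := hs.trans_le (re_le_norm s)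
  have h1 : (1 / s).re ≤ 2 := by
    refine (re_le_norm _).trans ?_
    rw [norm_div, norm_one, div_le_iff₀ (by linarith)]
    linarith
  have h2 : (digamma (s / 2)).re ≤ C + Real.log (1 + |s.im|) := by
    refine (re_le_norm _).trans ((hC (s / 2) (by simp; linarith) (by simp; linarith)).trans ?_)
    have : |(s / 2).im| ≤ |s.im| := by
      simp only [div_ofNat_im, abs_div, abs_two]
      linarith [abs_nonneg s.im]
    linarith [Real.log_le_log (by positivity) (by linarith : 1 + |(s / 2).im| ≤ 1 + |s.im|)]
  have h3 : 0 ≤ Real.log π := Real.log_nonneg (by linarith [Real.pi_gt_three])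
  linarith

/-- `‖L_c(2 + it)‖ ≤ Σ |c(n)| n^{-2}`. [folklore] -/
theorem norm_LSeries_two_add_le {c : ℕ → ℝ}
    (hsum : LSeriesSummable (fun n => ((c n : ℝ) : ℂ)) 2) (t : ℝ) :
    ‖LSeries (fun n => ((c n : ℝ) : ℂ)) (2 + t * I)‖ ≤
      ∑' n : ℕ, ‖term (fun n => ((c n : ℝ) : ℂ)) 2 n‖ := by
  have hn : ∀ n, ‖term (fun n => ((c n : ℝ) : ℂ)) (2 + t * I) n‖ =
      ‖term (fun n => ((c n : ℝ) : ℂ)) 2 n‖ := fun n => by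
    simp only [norm_term_eq, add_re, mul_re, I_re, I_im, ofReal_re, ofReal_im]
    norm_num
  have hs : Summable fun n => ‖term (fun n => ((c n : ℝ) : ℂ)) (2 + t * I) n‖ := by
    simp_rw [hn]; exact hsum.norm
  calc ‖LSeries (fun n => ((c n : ℝ) : ℂ)) (2 + t * I)‖
      ≤ ∑' n : ℕ, ‖term (fun n => ((c n : ℝ) : ℂ)) (2 + t * I) n‖ := norm_tsum_le_tsum_norm hs
    _ = ∑' n : ℕ, ‖term (fun n => ((c n : ℝ) : ℂ)) 2 n‖ := tsum_congr hn

/-- **Linear growth of `F` on `1/2 + δ ≤ Re s ≤ 2`** (Borel–Carathéodory from the one-sided majorant):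
if `F` is holomorphic on `Re s > 1/2`, equals `L_c − 1/(s−1)` on `Re s > 1` with `Σ|c(n)|n^{-σ} < ∞`
(`σ > 1`), and `Re F ≤ 1/2 + Re(1/s) + ½Re ψ(s/2) − ½log π` on `Re s > 1/2`, then for `0 < δ` there is
`C` with `‖F(σ+it)‖ ≤ C(1+|t|)` whenever `1/2 + δ ≤ σ ≤ 2`.
[cite: Titchmarsh1939, §5.5 (Borel–Carathéodory)] -/
theorem norm_le_linear_of_cara {c : ℕ → ℝ} {F : ℂ → ℂ}
    (hsum : ∀ σ : ℝ, 1 < σ → LSeriesSummable (fun n => ((c n : ℝ) : ℂ)) σ)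
    (hFd : DifferentiableOn ℂ F {s : ℂ | 1 / 2 < s.re})
    (hFL : ∀ s : ℂ, 1 < s.re → F s = LSeries (fun n => ((c n : ℝ) : ℂ)) s - 1 / (s - 1))
    (hFA : ∀ s : ℂ, 1 / 2 < s.re →
      (F s).re ≤ 1 / 2 + (1 / s).re + (digamma (s / 2)).re / 2 - Real.log π / 2)
    {δ : ℝ} (hδ : 0 < δ) :
    ∃ C : ℝ, 0 ≤ C ∧ ∀ σ : ℝ, 1 / 2 + δ ≤ σ → σ ≤ 2 → ∀ t : ℝ, ‖F (σ + t * I)‖ ≤ C * (1 + |t|) := by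
  obtain ⟨A₀, hA₀, hA⟩ := caraMajorant_le_log
  -- `‖F(2+it)‖ ≤ B`
  set B : ℝ := (∑' n : ℕ, ‖term (fun n => ((c n : ℝ) : ℂ)) 2 n‖) + 1 with hB
  have hB1 : 1 ≤ B := by
    have : 0 ≤ ∑' n : ℕ, ‖term (fun n => ((c n : ℝ) : ℂ)) 2 n‖ := tsum_nonneg fun _ => norm_nonneg _
    linarith
  have hF2 : ∀ t : ℝ, ‖F (2 + t * I)‖ ≤ B := by
    intro t
    rw [hFL _ (by simp)]
    refine (norm_sub_le _ _).trans (add_le_add (norm_LSeries_two_add_le (hsum 2 (by norm_num)) t) ?_)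
    have e : (2 : ℂ) + t * I - 1 = 1 + t * I := by ring
    rw [e, norm_div, norm_one]
    refine div_le_one_of_le₀ ?_ (norm_nonneg _)
    have := re_le_norm ((1 : ℂ) + t * I)
    simpa using this
  -- the constant
  refine ⟨B + 3 * (A₀ + B + 5 / 2) / δ + 3 / δ, by positivity, fun σ hσ1 hσ2 t => ?_⟩
  set s₀ : ℂ := 2 + t * I with hs₀
  set M : ℝ := A₀ + Real.log (1 + (|t| + 3 / 2)) + B with hM
  have hM0 : 0 < M := by
    have : 0 ≤ Real.log (1 + (|t| + 3 / 2)) := Real.log_nonneg (by linarith [abs_nonneg t])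
    linarith
  -- Borel–Carathéodory for `f(z) = F(s₀ + z) − F(s₀)` on `|z| < 3/2`
  set f : ℂ → ℂ := fun z => F (s₀ + z) - F s₀ with hf
  have hball : ∀ z ∈ ball (0 : ℂ) (3 / 2), 1 / 2 < (s₀ + z).re := by
    intro z hz
    rw [mem_ball_zero_iff] at hz
    have := abs_re_le_norm z
    simp only [hs₀, add_re, mul_re, I_re, I_im, ofReal_re, ofReal_im]
    have := neg_abs_le z.re
    norm_num
    linarith
  have hfd : DifferentiableOn ℂ f (ball 0 (3 / 2)) := by
    refine DifferentiableOn.sub_const ?_ _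
    exact hFd.comp ((differentiableOn_const _).add differentiableOn_id) fun z hz => hball z hz
  have hmaps : MapsTo f (ball 0 (3 / 2)) {z : ℂ | z.re ≤ M} := by
    intro z hz
    have hz' := hz
    rw [mem_ball_zero_iff] at hz'
    simp only [mem_setOf_eq, hf, sub_re]
    have h1 := hFA _ (hball z hz)
    have h2 := hA (s₀ + z) (hball z hz) (by
      have := re_le_norm z
      simp only [hs₀, add_re, mul_re, I_re, I_im, ofReal_re, ofReal_im]
      norm_num; linarith)
    have h3 : Real.log (1 + |(s₀ + z).im|) ≤ Real.log (1 + (|t| + 3 / 2)) := by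
      refine Real.log_le_log (by positivity) ?_
      have : |(s₀ + z).im| ≤ |t| + ‖z‖ := by
        simp only [hs₀, add_im, mul_im, I_re, I_im, ofReal_re, ofReal_im]
        norm_num
        exact (abs_add_le _ _).trans (add_le_add le_rfl (abs_im_le_norm z))
      linarith
    have h4 : -(F s₀).re ≤ B := (neg_le_abs _).trans ((abs_re_le_norm _).trans (hF2 t))
    linarith
  -- the point `z = σ − 2`
  set z : ℂ := ((σ - 2 : ℝ) : ℂ) with hz
  have hzn : ‖z‖ = 2 - σ := by
    rw [hz, norm_real, Real.norm_eq_abs, abs_of_nonpos (by linarith)]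
    ring
  have hzball : z ∈ ball (0 : ℂ) (3 / 2) := by
    rw [mem_ball_zero_iff, hzn]; linarith
  have key := Complex.borelCaratheodory hM0 hfd hmaps (by norm_num) hzball
  have hf0 : f 0 = 0 := by simp [hf]
  rw [hf0, norm_zero, zero_mul, zero_div, add_zero] at key
  have hfz : ‖f z‖ ≤ 3 * M / δ := by
    refine key.trans ?_
    rw [div_le_div_iff₀ (by rw [hzn]; linarith) hδ]
    have h1 : ‖z‖ ≤ 3 / 2 := by rw [hzn]; linarith
    have h2 : δ ≤ 3 / 2 - ‖z‖ := by rw [hzn]; linarith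
    have h3 : 2 * M * ‖z‖ * δ ≤ 3 * M * δ := by nlinarith [mul_nonneg hM0.le hδ.le]
    have h4 : 3 * M * δ ≤ 3 * M * (3 / 2 - ‖z‖) := by nlinarith
    linarith
  have hsz : s₀ + z = σ + t * I := by
    simp only [hs₀, hz]; push_cast; ring
  have hFσ : ‖F (σ + t * I)‖ ≤ B + 3 * M / δ := by
    have : F (σ + t * I) = f z + F s₀ := by simp [hf, hsz]
    rw [this]
    exact (norm_add_le _ _).trans (by linarith [hF2 t])
  -- bookkeeping: `M ≤ A₀ + B + 5/2 + |t|`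
  have hlog : Real.log (1 + (|t| + 3 / 2)) ≤ 5 / 2 + |t| := by
    have := Real.log_le_sub_one_of_pos (by positivity : 0 < 1 + (|t| + 3 / 2))
    linarith
  have hM' : 3 * M / δ ≤ 3 * (A₀ + B + 5 / 2) / δ + 3 / δ * |t| := by
    rw [show 3 * (A₀ + B + 5 / 2) / δ + 3 / δ * |t| = 3 * (A₀ + B + 5 / 2 + |t|) / δ by ring]
    exact div_le_div_of_nonneg_right (by nlinarith) hδ.le
  calc ‖F (σ + t * I)‖ ≤ B + 3 * M / δ := hFσ
    _ ≤ B + (3 * (A₀ + B + 5 / 2) / δ + 3 / δ * |t|) := by linarith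
    _ ≤ (B + 3 * (A₀ + B + 5 / 2) / δ + 3 / δ) * (1 + |t|) := by
        have h1 : 0 ≤ B := by linarith
        have h2 : 0 ≤ 3 * (A₀ + B + 5 / 2) / δ := by positivity
        have h3 : 0 ≤ 3 / δ := by positivity
        nlinarith [abs_nonneg t]

/-- **Anchor (registered sub-goal `caraGrowth` of stmt-RiemannHypothesis-16303)**: binder-free restatement of
`norm_le_linear_of_cara`. [folklore] -/
theorem caraGrowth :
    ∀ c : ℕ → ℝ, (∀ σ : ℝ, 1 < σ → LSeriesSummable (fun n => ((c n : ℝ) : ℂ)) σ) → ∀ F : ℂ → ℂ,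
      DifferentiableOn ℂ F {s : ℂ | 1 / 2 < s.re} →
      (∀ s : ℂ, 1 < s.re → F s = LSeries (fun n => ((c n : ℝ) : ℂ)) s - 1 / (s - 1)) →
      (∀ s : ℂ, 1 / 2 < s.re →
        (F s).re ≤ 1 / 2 + (1 / s).re + (Complex.digamma (s / 2)).re / 2 - Real.log Real.pi / 2) →
      ∀ δ : ℝ, 0 < δ → ∃ C : ℝ, 0 ≤ C ∧ ∀ σ : ℝ, 1 / 2 + δ ≤ σ → σ ≤ 2 → ∀ t : ℝ,
        ‖F (σ + t * Complex.I)‖ ≤ C * (1 + |t|) :=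
  fun _ hsum _ hFd hFL hFA _ hδ => norm_le_linear_of_cara hsum hFd hFL hFA hδ

end Summit.RiemannHypothesis.RiemannHypothesis.Theorems.SignConeConeMagnification

end
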